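import Mathlib
import Literature.Probability.PointProcesses.LensConsistentLaw
import Literature.MathematicalPhysics.StatisticalMechanics.Crystallization
import HarnessLib

/-!
# Route `FrustrationRangeCertificates` — posited objects of the primal (finitely additive) formulation

Definitions posited by route `FrustrationRangeCertificates` (crux `PatternPricedCertificates`,
stmt-AtomisticToContinuum-12974, line `registered`, reshaped by lead c1 on 2026-08-17): the PRIMAL side of the
finite-level transfer LP, phrased with finitely additive laws (MEANS) so that strong duality
(`…Theorems.PatternPricedCertificates.stub_meanDuality`, Hahn–Banach) and the level lift
(`stub_levelLift`, Banach limit) are theorems. Everything here so far lived INLINE in the stub signatures and in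
`Theorems/FrustrationRangeCertificatesPatternPricedCertificates{PrimalCore,Stub*}.lean`; this file names the notions
so that later files (compactness `stationaryMeansRigidity_of`, refuters' instances, the σ-additive bridge to
stmt-9224) can be stated in ≤ 4000 characters. The unfolding lemmas `*_iff` / `rfl` show the named forms are
the inline forms.

* `transportOf r L g S` — the level-`(r, L)` transport of a rule `g` at the rooted pattern `S`:
  `Σ_{v ∈ lens r L S} [g v (B_r S) (B_r (reroot S v)) − g (−v) (B_r (reroot S v)) (B_r S)]` (the integrand of the
  finite-level mass-transport identity of `Literature.Probability.PointProcesses.LensConsistentLaw`).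
* `IsPatternMean δ L m` — `m : (Finset E → ℝ) → ℝ` is additive, homogeneous, `≥ 0` on functionals valued in `[0,1]` on
  `(δ, L)`-admissible patterns, and `m 1 = 1` (a finitely additive probability on bounded pattern functionals; values on
  functionals unbounded on admissible patterns are junk by design).
* `IsLensConsistentMean δ r L m` — a pattern mean killing `transportOf r L g` for every bounded `g`.
* `IsStationaryMeanFamily δ ℓ` — `ℓ : ℝ → (Finset E → ℝ) → ℝ`, each `ℓ ρ` a pattern mean at `(δ, ρ)`, projective
  (`ℓ ρ' (f ∘ B_ρ) = ℓ ρ f`, `ρ ≤ ρ'`) and lens-consistent at every level `(r, ρ)`, `0 ≤ r`: the finitely additive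
  point-stationary (Palm-type) laws of rooted `δ`-separated configurations.
* `badIndicator P R ε S ∈ {0, 1}` — the route's `(R, ε)`-defect predicate of `insert 0 S` against the periodic `P`
  (verbatim the predicate of `BulkDefectVanish`, stmt-0751, in pattern form); `halfEnergy S = (Σ_{v ∈ S} V_LJ ‖v‖)/2`.
* The three propositions of the line: `StationaryMeansRigidity` (priced core), `QualitativeMeansRigidity` (THE open
  core: minimal-energy stationary mean families are `P`-patterned at every scale), `UnpricedMeanBound` (energy of
  stationary mean families `≥ ⨅_Q e(Q)`; believed provable).

Design: `E` is a general normed group with decidable equality for the mean notions (the route: `EuclideanSpace ℝ (Fin 3)`,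
whose `DecidableEq` instance is the one instance resolution finds, as in the registered stub texts); the three propositions are stated for `ℝ³` and Lennard-Jones exactly as registered on the crux item
(so `Iff.rfl` against the registered stub texts). NOT here: σ-additive Palm laws (stmt-9224's vocabulary) and the
bridge; finite-level primal propositions (see `stub_levelLift`).
-/

noncomputable section

open scoped BigOperators Classical

namespace Summit.AtomisticToContinuum.Crystallization.Theorems.PatternPricedCertificates

open Literature.Probability.PointProcesses (IsRootedPattern ballPattern lens reroot)
open Literature.MathematicalPhysics.StatisticalMechanics (lennardJones PeriodicConfiguration)

section General

variable {E : Type*} [NormedAddCommGroup E] [DecidableEq E]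

/-- **The level-`(r, L)` transport** of a rule `g` at a rooted pattern `S`:
`Σ_{v ∈ lens r L S} [g v (B_r S) (B_r (reroot S v)) − g (−v) (B_r (reroot S v)) (B_r S)]`
(received minus sent along displacements in the lens range; the integrand of the finite-level mass-transport
identity, Aldous–Lyons). [folklore] -/
def transportOf (r L : ℝ) (g : E → Finset E → Finset E → ℝ) (S : Finset E) : ℝ :=
  ∑ v ∈ lens r L S, (g v (ballPattern r S) (ballPattern r (reroot S v)) -
    g (-v) (ballPattern r (reroot S v)) (ballPattern r S))

/-- **A (pattern) mean at level `(δ, L)`**: a functional on all pattern functionals which is additive, homogeneous,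
non-negative on functionals with values in `[0, 1]` on the `(δ, L)`-admissible rooted patterns, and normalised.
[folklore] -/
def IsPatternMean (δ L : ℝ) (m : (Finset E → ℝ) → ℝ) : Prop :=
  (∀ f₁ f₂ : Finset E → ℝ, m (f₁ + f₂) = m f₁ + m f₂) ∧
  (∀ (t : ℝ) (f : Finset E → ℝ), m (t • f) = t * m f) ∧
  (∀ f : Finset E → ℝ, (∀ S : Finset E, IsRootedPattern δ L S → 0 ≤ f S ∧ f S ≤ 1) → 0 ≤ m f) ∧
  m (fun _ => 1) = 1

/-- **A lens-consistent mean at level `(δ, r, L)`**: a pattern mean killing the transport of every bounded rule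
(the finitely additive points of the continuum Kaburagi–Kanamori polytope at level `(r, L)`). [folklore] -/
def IsLensConsistentMean (δ r L : ℝ) (m : (Finset E → ℝ) → ℝ) : Prop :=
  IsPatternMean δ L m ∧
  ∀ g : E → Finset E → Finset E → ℝ, (∃ M : ℝ, ∀ v p q, |g v p q| ≤ M) →
    m (fun S => transportOf r L g S) = 0

/-- **A point-stationary mean family** on rooted `δ`-separated configurations: `ρ ↦ ℓ ρ`, each a pattern mean at
`(δ, ρ)`, projective under cutting to smaller balls and lens-consistent at every level `(r, ρ)` with `0 ≤ r`
(the finitely additive twin of a point-stationary / Palm law). [folklore] -/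
def IsStationaryMeanFamily (δ : ℝ) (ℓ : ℝ → (Finset E → ℝ) → ℝ) : Prop :=
  (∀ ρ : ℝ, IsPatternMean δ ρ (ℓ ρ)) ∧
  (∀ ρ ρ' : ℝ, ρ ≤ ρ' → ∀ f : Finset E → ℝ, ℓ ρ' (fun S => f (ballPattern ρ S)) = ℓ ρ f) ∧
  (∀ r ρ : ℝ, 0 ≤ r → ∀ g : E → Finset E → Finset E → ℝ, (∃ M : ℝ, ∀ v p q, |g v p q| ≤ M) →
    ℓ ρ (fun S => transportOf r ρ g S) = 0)

/-- Half the truncated one-centre Lennard-Jones energy of a rooted pattern. [folklore] -/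
def halfEnergy (S : Finset E) : ℝ :=
  (∑ v ∈ S, lennardJones ‖v‖) / 2

end General

section Euclidean

variable {d : ℕ}

/-- **The defect indicator** of route FrustrationRangeCertificates / hinge `BulkDefectVanish` (stmt-0751) in pattern
form: `0` if `insert 0 S` is `(R, ε)`-matched both ways to an isometric copy `A (P.points)` of the periodic `P`,
`1` otherwise. [folklore] -/
def badIndicator (P : PeriodicConfiguration d) (R ε : ℝ) (S : Finset (EuclideanSpace ℝ (Fin d))) : ℝ :=
  if (∃ A : EuclideanSpace ℝ (Fin d) →ₗᵢ[ℝ] EuclideanSpace ℝ (Fin d),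
      (∀ p ∈ P.points, ‖p‖ ≤ R → ∃ v ∈ insert (0 : EuclideanSpace ℝ (Fin d)) S, dist v (A p) ≤ ε) ∧
      (∀ v ∈ insert (0 : EuclideanSpace ℝ (Fin d)) S, ‖v‖ ≤ R → ∃ p ∈ P.points, dist v (A p) ≤ ε))
  then 0 else 1

/-- The defect indicator takes values in `{0, 1}`. [folklore] -/
theorem badIndicator_mem (P : PeriodicConfiguration d) (R ε : ℝ) (S : Finset (EuclideanSpace ℝ (Fin d))) :
    0 ≤ badIndicator P R ε S ∧ badIndicator P R ε S ≤ 1 := by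
  unfold badIndicator
  split_ifs <;> norm_num

end Euclidean

/-! ### The three propositions of line `registered` (ℝ³, Lennard-Jones) -/

/-- **Priced rigidity of point-stationary mean families** (the v2–v5 core `stub_stationaryMeansRigidity` of crux
stmt-AtomisticToContinuum-12974): one periodic `P` such that for all `δ, R, ε, θ > 0` there are `κ ∈ (0, 1]`, `c`
and a periodic `Q` with `e(Q) ≤ c + κθ` such that every point-stationary mean family satisfies
`c + κ ℓ ρ (bad_{P,R,ε}) ≤ ℓ ρ (½h)` at every `ρ ≥ max (R + ε) 1`. Implies the crux
(`patternPricedCertificates_of_stationaryMeansRigidity`). [conjecture] -/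
def StationaryMeansRigidity : Prop :=
  ∃ P : PeriodicConfiguration 3, ∀ δ R ε θ : ℝ, 0 < δ → 0 < R → 0 < ε → 0 < θ →
    ∃ (κ c : ℝ) (Q : PeriodicConfiguration 3), 0 < κ ∧ κ ≤ 1 ∧
      Q.energyPerParticle lennardJones ≤ c + κ * θ ∧
      ∀ ℓ : ℝ → (Finset (EuclideanSpace ℝ (Fin 3)) → ℝ) → ℝ, IsStationaryMeanFamily δ ℓ →
        ∀ ρ : ℝ, R + ε ≤ ρ → 1 ≤ ρ →
          c + κ * ℓ ρ (fun S => badIndicator P R ε S) ≤ ℓ ρ (fun S => halfEnergy S)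

/-- **THE OPEN CORE (qualitative Palm rigidity for point-stationary mean families)** (the v6 stub
`stub_qualitativeMeansRigidity`): one periodic `P` such that for every `δ > 0` every point-stationary mean family of
minimal energy (`∀ η > 0 ∃ ρ ≥ 1, ℓ ρ (½h) ≤ ⨅_Q e(Q) + η`) is `P`-patterned at every scale:
`ℓ (R + ε) (bad_{P,R,ε}) = 0`. The finitely additive, all-scales twin of `PalmRigidity` (stmt-9224). [conjecture] -/
def QualitativeMeansRigidity : Prop :=
  ∃ P : PeriodicConfiguration 3, ∀ δ : ℝ, 0 < δ →
    ∀ ℓ : ℝ → (Finset (EuclideanSpace ℝ (Fin 3)) → ℝ) → ℝ, IsStationaryMeanFamily δ ℓ →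
      (∀ η : ℝ, 0 < η → ∃ ρ : ℝ, 1 ≤ ρ ∧ ℓ ρ (fun S => halfEnergy S) ≤
        (⨅ Q : PeriodicConfiguration 3, Q.energyPerParticle lennardJones) + η) →
      ∀ R ε : ℝ, 0 < R → 0 < ε → ℓ (R + ε) (fun S => badIndicator P R ε S) = 0

/-- **Unpriced energy bound for point-stationary mean families** (the v6 stub `stub_unpricedMeanBound`; "no
duality gap at `κ = 0`", the unpriced half of the route's TransferDuality): for every `δ > 0`, every
point-stationary mean family and every `ρ ≥ 1`, `⨅_Q e(Q) ≤ ℓ ρ (½h)`. Believed provable (Følner / allocation);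
filed as a conjecture until it is. [conjecture] -/
def UnpricedMeanBound : Prop :=
  ∀ δ : ℝ, 0 < δ → ∀ ℓ : ℝ → (Finset (EuclideanSpace ℝ (Fin 3)) → ℝ) → ℝ, IsStationaryMeanFamily δ ℓ →
    ∀ ρ : ℝ, 1 ≤ ρ → (⨅ Q : PeriodicConfiguration 3, Q.energyPerParticle lennardJones) ≤
      ℓ ρ (fun S => halfEnergy S)

/-! ### Unfolding to the registered (inline) stub texts -/

/-- `QualitativeMeansRigidity` is, word for word after unfolding, the registered stub
`stub_qualitativeMeansRigidity` of crux stmt-AtomisticToContinuum-12974 (curried family axioms). [folklore] -/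
theorem qualitativeMeansRigidity_iff :
    QualitativeMeansRigidity ↔
    ∃ P : Literature.MathematicalPhysics.StatisticalMechanics.PeriodicConfiguration 3, ∀ δ : ℝ, 0 < δ → ∀ ℓ : ℝ → (Finset (EuclideanSpace ℝ (Fin 3)) → ℝ) → ℝ,
      (∀ (ρ : ℝ) (f₁ f₂ : Finset (EuclideanSpace ℝ (Fin 3)) → ℝ), ℓ ρ (f₁ + f₂) = ℓ ρ f₁ + ℓ ρ f₂) →
      (∀ (ρ t : ℝ) (f : Finset (EuclideanSpace ℝ (Fin 3)) → ℝ), ℓ ρ (t • f) = t * ℓ ρ f) →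
      (∀ (ρ : ℝ) (f : Finset (EuclideanSpace ℝ (Fin 3)) → ℝ), (∀ S : Finset (EuclideanSpace ℝ (Fin 3)), Literature.Probability.PointProcesses.IsRootedPattern δ ρ S → 0 ≤ f S ∧ f S ≤ 1) → 0 ≤ ℓ ρ f) →
      (∀ ρ : ℝ, ℓ ρ (fun _ => 1) = 1) →
      (∀ ρ ρ' : ℝ, ρ ≤ ρ' → ∀ f : Finset (EuclideanSpace ℝ (Fin 3)) → ℝ, ℓ ρ' (fun S => f (Literature.Probability.PointProcesses.ballPattern ρ S)) = ℓ ρ f) →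
      (∀ r ρ : ℝ, 0 ≤ r → ∀ g : EuclideanSpace ℝ (Fin 3) → Finset (EuclideanSpace ℝ (Fin 3)) → Finset (EuclideanSpace ℝ (Fin 3)) → ℝ, (∃ M : ℝ, ∀ v p q, |g v p q| ≤ M) →
        ℓ ρ (fun S => ∑ v ∈ Literature.Probability.PointProcesses.lens r ρ S, (g v (Literature.Probability.PointProcesses.ballPattern r S) (Literature.Probability.PointProcesses.ballPattern r (Literature.Probability.PointProcesses.reroot S v)) - g (-v) (Literature.Probability.PointProcesses.ballPattern r (Literature.Probability.PointProcesses.reroot S v)) (Literature.Probability.PointProcesses.ballPattern r S))) = 0) →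
      (∀ η : ℝ, 0 < η → ∃ ρ : ℝ, 1 ≤ ρ ∧ ℓ ρ (fun S => (∑ v ∈ S, Literature.MathematicalPhysics.StatisticalMechanics.lennardJones ‖v‖) / 2) ≤ (⨅ Q : Literature.MathematicalPhysics.StatisticalMechanics.PeriodicConfiguration 3, Q.energyPerParticle Literature.MathematicalPhysics.StatisticalMechanics.lennardJones) + η) →
      ∀ R ε : ℝ, 0 < R → 0 < ε →
        ℓ (R + ε) (fun S => (if (∃ A : EuclideanSpace ℝ (Fin 3) →ₗᵢ[ℝ] EuclideanSpace ℝ (Fin 3), (∀ p ∈ P.points, ‖p‖ ≤ R → ∃ v ∈ insert (0 : EuclideanSpace ℝ (Fin 3)) S, dist v (A p) ≤ ε) ∧ (∀ v ∈ insert (0 : EuclideanSpace ℝ (Fin 3)) S, ‖v‖ ≤ R → ∃ p ∈ P.points, dist v (A p) ≤ ε)) then (0 : ℝ) else 1)) = 0 := by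
  unfold QualitativeMeansRigidity IsStationaryMeanFamily IsPatternMean transportOf halfEnergy badIndicator
  constructor
  · rintro ⟨P, hP⟩
    refine ⟨P, fun δ hδ ℓ h1 h2 h3 h4 h5 h6 => hP δ hδ ℓ ⟨fun ρ => ⟨h1 ρ, h2 ρ, h3 ρ, h4 ρ⟩, h5, h6⟩⟩
  · rintro ⟨P, hP⟩
    refine ⟨P, fun δ hδ ℓ hℓ => hP δ hδ ℓ (fun ρ => (hℓ.1 ρ).1) (fun ρ => (hℓ.1 ρ).2.1)
      (fun ρ => (hℓ.1 ρ).2.2.1) (fun ρ => (hℓ.1 ρ).2.2.2) hℓ.2.1 hℓ.2.2⟩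

/-- `UnpricedMeanBound` unfolds to the registered stub `stub_unpricedMeanBound`. [folklore] -/
theorem unpricedMeanBound_iff :
    UnpricedMeanBound ↔
    ∀ δ : ℝ, 0 < δ → ∀ ℓ : ℝ → (Finset (EuclideanSpace ℝ (Fin 3)) → ℝ) → ℝ,
      (∀ (ρ : ℝ) (f₁ f₂ : Finset (EuclideanSpace ℝ (Fin 3)) → ℝ), ℓ ρ (f₁ + f₂) = ℓ ρ f₁ + ℓ ρ f₂) →
      (∀ (ρ t : ℝ) (f : Finset (EuclideanSpace ℝ (Fin 3)) → ℝ), ℓ ρ (t • f) = t * ℓ ρ f) →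
      (∀ (ρ : ℝ) (f : Finset (EuclideanSpace ℝ (Fin 3)) → ℝ), (∀ S : Finset (EuclideanSpace ℝ (Fin 3)), Literature.Probability.PointProcesses.IsRootedPattern δ ρ S → 0 ≤ f S ∧ f S ≤ 1) → 0 ≤ ℓ ρ f) →
      (∀ ρ : ℝ, ℓ ρ (fun _ => 1) = 1) →
      (∀ ρ ρ' : ℝ, ρ ≤ ρ' → ∀ f : Finset (EuclideanSpace ℝ (Fin 3)) → ℝ, ℓ ρ' (fun S => f (Literature.Probability.PointProcesses.ballPattern ρ S)) = ℓ ρ f) →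
      (∀ r ρ : ℝ, 0 ≤ r → ∀ g : EuclideanSpace ℝ (Fin 3) → Finset (EuclideanSpace ℝ (Fin 3)) → Finset (EuclideanSpace ℝ (Fin 3)) → ℝ, (∃ M : ℝ, ∀ v p q, |g v p q| ≤ M) →
        ℓ ρ (fun S => ∑ v ∈ Literature.Probability.PointProcesses.lens r ρ S, (g v (Literature.Probability.PointProcesses.ballPattern r S) (Literature.Probability.PointProcesses.ballPattern r (Literature.Probability.PointProcesses.reroot S v)) - g (-v) (Literature.Probability.PointProcesses.ballPattern r (Literature.Probability.PointProcesses.reroot S v)) (Literature.Probability.PointProcesses.ballPattern r S))) = 0) →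
      ∀ ρ : ℝ, 1 ≤ ρ → (⨅ Q : Literature.MathematicalPhysics.StatisticalMechanics.PeriodicConfiguration 3, Q.energyPerParticle Literature.MathematicalPhysics.StatisticalMechanics.lennardJones) ≤
        ℓ ρ (fun S => (∑ v ∈ S, Literature.MathematicalPhysics.StatisticalMechanics.lennardJones ‖v‖) / 2) := by
  unfold UnpricedMeanBound IsStationaryMeanFamily IsPatternMean transportOf halfEnergy
  constructor
  · intro h δ hδ ℓ h1 h2 h3 h4 h5 h6
    exact h δ hδ ℓ ⟨fun ρ => ⟨h1 ρ, h2 ρ, h3 ρ, h4 ρ⟩, h5, h6⟩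
  · intro h δ hδ ℓ hℓ
    exact h δ hδ ℓ (fun ρ => (hℓ.1 ρ).1) (fun ρ => (hℓ.1 ρ).2.1) (fun ρ => (hℓ.1 ρ).2.2.1)
      (fun ρ => (hℓ.1 ρ).2.2.2) hℓ.2.1 hℓ.2.2

/-- `StationaryMeansRigidity` unfolds to the hypothesis of `patternPricedCertificates_of_stationaryMeansRigidity`
(the v2–v5 registered core). [folklore] -/
theorem stationaryMeansRigidity_iff :
    StationaryMeansRigidity ↔
    ∃ P : Literature.MathematicalPhysics.StatisticalMechanics.PeriodicConfiguration 3, ∀ δ R ε θ : ℝ, 0 < δ → 0 < R → 0 < ε → 0 < θ →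
      ∃ (κ c : ℝ) (Q : Literature.MathematicalPhysics.StatisticalMechanics.PeriodicConfiguration 3), 0 < κ ∧ κ ≤ 1 ∧
        Q.energyPerParticle Literature.MathematicalPhysics.StatisticalMechanics.lennardJones ≤ c + κ * θ ∧
        ∀ ℓ : ℝ → (Finset (EuclideanSpace ℝ (Fin 3)) → ℝ) → ℝ,
          (∀ (ρ : ℝ) (f₁ f₂ : Finset (EuclideanSpace ℝ (Fin 3)) → ℝ), ℓ ρ (f₁ + f₂) = ℓ ρ f₁ + ℓ ρ f₂) →
          (∀ (ρ t : ℝ) (f : Finset (EuclideanSpace ℝ (Fin 3)) → ℝ), ℓ ρ (t • f) = t * ℓ ρ f) →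
          (∀ (ρ : ℝ) (f : Finset (EuclideanSpace ℝ (Fin 3)) → ℝ), (∀ S : Finset (EuclideanSpace ℝ (Fin 3)), Literature.Probability.PointProcesses.IsRootedPattern δ ρ S → 0 ≤ f S ∧ f S ≤ 1) → 0 ≤ ℓ ρ f) →
          (∀ ρ : ℝ, ℓ ρ (fun _ => 1) = 1) →
          (∀ ρ ρ' : ℝ, ρ ≤ ρ' → ∀ f : Finset (EuclideanSpace ℝ (Fin 3)) → ℝ, ℓ ρ' (fun S => f (Literature.Probability.PointProcesses.ballPattern ρ S)) = ℓ ρ f) →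
          (∀ r ρ : ℝ, 0 ≤ r → ∀ g : EuclideanSpace ℝ (Fin 3) → Finset (EuclideanSpace ℝ (Fin 3)) → Finset (EuclideanSpace ℝ (Fin 3)) → ℝ, (∃ M : ℝ, ∀ v p q, |g v p q| ≤ M) →
            ℓ ρ (fun S => ∑ v ∈ Literature.Probability.PointProcesses.lens r ρ S, (g v (Literature.Probability.PointProcesses.ballPattern r S) (Literature.Probability.PointProcesses.ballPattern r (Literature.Probability.PointProcesses.reroot S v)) - g (-v) (Literature.Probability.PointProcesses.ballPattern r (Literature.Probability.PointProcesses.reroot S v)) (Literature.Probability.PointProcesses.ballPattern r S))) = 0) →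
          ∀ ρ : ℝ, R + ε ≤ ρ → 1 ≤ ρ →
            c + κ * ℓ ρ (fun S => (if (∃ A : EuclideanSpace ℝ (Fin 3) →ₗᵢ[ℝ] EuclideanSpace ℝ (Fin 3), (∀ p ∈ P.points, ‖p‖ ≤ R → ∃ v ∈ insert (0 : EuclideanSpace ℝ (Fin 3)) S, dist v (A p) ≤ ε) ∧ (∀ v ∈ insert (0 : EuclideanSpace ℝ (Fin 3)) S, ‖v‖ ≤ R → ∃ p ∈ P.points, dist v (A p) ≤ ε)) then (0 : ℝ) else 1)) ≤
              ℓ ρ (fun S => (∑ v ∈ S, Literature.MathematicalPhysics.StatisticalMechanics.lennardJones ‖v‖) / 2) := by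
  unfold StationaryMeansRigidity IsStationaryMeanFamily IsPatternMean transportOf halfEnergy badIndicator
  constructor
  · rintro ⟨P, hP⟩
    refine ⟨P, fun δ R ε θ hδ hR hε hθ => ?_⟩
    obtain ⟨κ, c, Q, hκ0, hκ1, hQ, h⟩ := hP δ R ε θ hδ hR hε hθ
    exact ⟨κ, c, Q, hκ0, hκ1, hQ, fun ℓ h1 h2 h3 h4 h5 h6 => h ℓ ⟨fun ρ => ⟨h1 ρ, h2 ρ, h3 ρ, h4 ρ⟩, h5, h6⟩⟩
  · rintro ⟨P, hP⟩
    refine ⟨P, fun δ R ε θ hδ hR hε hθ => ?_⟩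
    obtain ⟨κ, c, Q, hκ0, hκ1, hQ, h⟩ := hP δ R ε θ hδ hR hε hθ
    exact ⟨κ, c, Q, hκ0, hκ1, hQ, fun ℓ hℓ => h ℓ (fun ρ => (hℓ.1 ρ).1) (fun ρ => (hℓ.1 ρ).2.1)
      (fun ρ => (hℓ.1 ρ).2.2.1) (fun ρ => (hℓ.1 ρ).2.2.2) hℓ.2.1 hℓ.2.2⟩

end Summit.AtomisticToContinuum.Crystallization.Theorems.PatternPricedCertificates

end
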